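import Literature.MathematicalPhysics.QuantumLattice.HubbardMatsubaraShellNearIdentity
import HarnessLib

/-!
# Two Matsubara cutoffs on ONE time grid: the cutoff-`M″` covariance is the cutoff-`M` covariance plus the shell, for the SAME grid vertex

Topic `MathematicalPhysics/QuantumLattice`; the grid form of the exact cutoff embedding (`HubbardMatsubaraCutoffBlocks`: `C″^K_{>Λ} = Eᵀ C^K_{>Λ} E + S`).
The position–time substitution of the cutoff-`M` fields IS the window compression of that of the cutoff-`M″` fields
(`windowMatrix_mul_gridSubMatrix`: the plane waves read only the frequency, which the window embedding preserves).  Hence on ANY grid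
`(x, τ) : P → (ℤ/L)² × ℝ`:

  `S″ᵀ·C″^K_{>Λ}·S″ = Sᵀ·C^K_{>Λ}·S + S″ᵀ·S_shell·S″`   (**`gridSub_hubbardCovAboveCT_eq_add_shell`**),

with `S″ = gridSubMatrix L M″ β x τ`, `S = gridSubMatrix L M β x τ` — and the grid interaction `W = hubbardGridInteraction + hubbardGridCounterQuadratic`
does not know the cutoff.  So by the semigroup property (**`effAction_gridSub_two_cutoffs`**)

  `effAction (S″ᵀC″S″) W = effAction (SᵀCS) (effAction (S″ᵀ S_shell S″) W)`:

the cutoff-`M″` scale-`Λ` effective action on the grid is the cutoff-`M` one started from the shell-integrated vertex `W′ = effAction S_g W`, whose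
distance to `W` is the near-identity bound of `HubbardMatsubaraShellNearIdentity` (**`effAction_gridSub_two_cutoffs_of_small`** packages the unit
hypothesis from there).  The two-cutoff comparison of every kernel is therefore ONE scale map `V ↦ effAction (SᵀC^K_{>Λ}S) V` at the two initial
interactions `W′`, `W` on the same grid algebra.

Everything is proved; no definitions, no named facts.

## Sources
M. Salmhofer, *Renormalization* (1999), §2.5.1 (2.105)–(2.106), App. B.2 (B.23)–(B.25) [`Salmhofer1999`]; G. Benfatto, A. Giuliani,
V. Mastropietro, Ann. Henri Poincaré 7 (2006) 809–898, §2.1 (2.5)–(2.6) [`BenfattoGiulianiMastropietro2006`].  The `[cite: …]` tags LOCATE the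
constructs; the statements are routine bookkeeping.
-/

noncomputable section

namespace Literature.MathematicalPhysics.QuantumLattice

open GrassmannAlgebra Finset Literature.Probability.LatticeModels
open scoped ComplexConjugate

variable {L : ℕ} [NeZero L] {M M'' : ℕ} {P : Type*}

omit [NeZero L] in
/-- The plane wave of an embedded label is the plane wave of the label (same frequency, same momentum). [cite: BenfattoGiulianiMastropietro2006, §2.1 (2.5)] -/
theorem vertexPlaneWave_emb (h : M ≤ M'') (β : ℝ) (c : Fin 2) (k : FreqMomentum L M) (x : TorusSite 2 L) (τ : ℝ) :
    vertexPlaneWave L M'' β c (FreqMomentum.emb h k) x τ = vertexPlaneWave L M β c k x τ := by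
  simp only [vertexPlaneWave, vertexPhase, FreqMomentum.emb_fst, FreqMomentum.emb_snd, matsubaraFreq_emb]

/-- **The cutoff-`M` grid substitution is the window compression of the cutoff-`M″` one**: `E · S″ = S`.
[cite: BenfattoGiulianiMastropietro2006, §2.1 (2.5)] -/
theorem windowMatrix_mul_gridSubMatrix (h : M ≤ M'') (β : ℝ) (x : P → TorusSite 2 L) (τ : P → ℝ) :
    windowMatrix L h * gridSubMatrix L M'' β x τ = gridSubMatrix L M β x τ := by
  ext X Y
  rw [Matrix.mul_apply, Finset.sum_eq_single (HubbardFieldIdx.emb h X)]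
  · rw [windowMatrix_apply, if_pos rfl, one_mul, gridSubMatrix_apply, gridSubMatrix_apply, HubbardFieldIdx.emb_fst_fst,
      HubbardFieldIdx.emb_fst_snd, HubbardFieldIdx.emb_snd, vertexPlaneWave_emb]
  · intro X'' _ hne
    rw [windowMatrix_apply, if_neg (Ne.symm hne), zero_mul]
  · intro hX; exact absurd (Finset.mem_univ _) hX

/-- **On one grid, the cutoff-`M″` scale-`Λ` covariance is the cutoff-`M` one plus the shell**:
`S″ᵀ·C″^K_{>Λ}·S″ = Sᵀ·C^K_{>Λ}·S + S″ᵀ·S_shell·S″`. [cite: Salmhofer1999, App. B.2 (B.23)-(B.25)] -/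
theorem gridSub_hubbardCovAboveCT_eq_add_shell (h : M ≤ M'') (β μ hs : ℝ) (K : TrigPolyC4v) (Λ : ℝ) (x : P → TorusSite 2 L) (τ : P → ℝ) :
    (gridSubMatrix L M'' β x τ).transpose * hubbardCovAboveCT L M'' β μ hs K Λ * gridSubMatrix L M'' β x τ =
      (gridSubMatrix L M β x τ).transpose * hubbardCovAboveCT L M β μ hs K Λ * gridSubMatrix L M β x τ +
        (gridSubMatrix L M'' β x τ).transpose * hubbardCovShellCT L h β μ hs K Λ * gridSubMatrix L M'' β x τ := by
  rw [hubbardCovAboveCT_eq_window_add_shell h β μ hs K Λ, Matrix.mul_add, Matrix.add_mul, ← windowMatrix_mul_gridSubMatrix h β x τ,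
    Matrix.transpose_mul]
  simp only [Matrix.mul_assoc]

variable [Fintype P]

/-- **The cutoff-`M″` theory on the grid is the cutoff-`M` theory started from the shell-integrated vertex**:
`effAction (S″ᵀC″_{>Λ}S″) W = effAction (SᵀC_{>Λ}S) (effAction (S″ᵀ S_shell S″) W)` for every `W` whose shell partition function is a unit.
[cite: Salmhofer1999, §2.5.1 (2.106)] -/
theorem effAction_gridSub_two_cutoffs (h : M ≤ M'') (β μ hs : ℝ) (K : TrigPolyC4v) (Λ : ℝ) (x : P → TorusSite 2 L) (τ : P → ℝ)
    (W : GrassmannAlgebra ℂ (GridLeg P))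
    (hZ : IsUnit (effPartitionFn ℂ ((gridSubMatrix L M'' β x τ).transpose * hubbardCovShellCT L h β μ hs K Λ * gridSubMatrix L M'' β x τ) W)) :
    effAction ℂ ((gridSubMatrix L M'' β x τ).transpose * hubbardCovAboveCT L M'' β μ hs K Λ * gridSubMatrix L M'' β x τ) W =
      effAction ℂ ((gridSubMatrix L M β x τ).transpose * hubbardCovAboveCT L M β μ hs K Λ * gridSubMatrix L M β x τ)
        (effAction ℂ ((gridSubMatrix L M'' β x τ).transpose * hubbardCovShellCT L h β μ hs K Λ * gridSubMatrix L M'' β x τ) W) := by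
  rw [gridSub_hubbardCovAboveCT_eq_add_shell h, effAction_add ℂ _ _ _ hZ]

/-- … and for the Boltzmann factors, unconditionally. [cite: Salmhofer1999, §2.5.1 (2.105)] -/
theorem effBoltzmann_gridSub_two_cutoffs (h : M ≤ M'') (β μ hs : ℝ) (K : TrigPolyC4v) (Λ : ℝ) (x : P → TorusSite 2 L) (τ : P → ℝ)
    (W : GrassmannAlgebra ℂ (GridLeg P)) :
    effBoltzmann ℂ ((gridSubMatrix L M'' β x τ).transpose * hubbardCovAboveCT L M'' β μ hs K Λ * gridSubMatrix L M'' β x τ) W =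
      gaussConv ℂ ((gridSubMatrix L M β x τ).transpose * hubbardCovAboveCT L M β μ hs K Λ * gridSubMatrix L M β x τ)
        (effBoltzmann ℂ ((gridSubMatrix L M'' β x τ).transpose * hubbardCovShellCT L h β μ hs K Λ * gridSubMatrix L M'' β x τ) W) := by
  rw [gridSub_hubbardCovAboveCT_eq_add_shell h, effBoltzmann_add]

/-- **The two-cutoff comparison of the scale-`Λ` grid effective actions is ONE scale map at two initial interactions**: on the regular
`N`-grid, for the grid vertex `W = V_N + 𝒩_{K,N}` of the counterterm scheme (seed `0`, `1 ≤ M < M″`, `0 < Λ ≤ π(2M+1)/β`, and the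
smallness `θ < 1` of the shell step, which makes the shell partition function a unit), with `W′ := effAction S_g W`:
`effAction C″_g W = effAction C_g W′` — and `W′ − W` obeys `sum_norm_kernel_effAction_shell_sub_self_le`. [cite: Salmhofer1999, §2.5.1 (2.106)] -/
theorem effAction_gridSub_two_cutoffs_of_small {N : ℕ} [NeZero N] {β : ℝ} (hβ : 0 < β) (hM : 1 ≤ M) (h : M ≤ M'') (hMM : M < M'')
    (U μ : ℝ) (K : TrigPolyC4v) {Λ : ℝ} (hΛ : 0 < Λ) (hΛle : Λ ≤ Real.pi * (2 * M + 1) / β) {α : ℝ} (hα : 0 < α)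
    (hrow : ∀ X, ∑ Y, ‖((hubbardGridSub L M'' β N).transpose * hubbardCovShellCT L h β μ 0 K Λ * hubbardGridSub L M'' β N) X Y‖ ≤ α)
    (hcol : ∀ Y, ∑ X, ‖((hubbardGridSub L M'' β N).transpose * hubbardCovShellCT L h β μ 0 K Λ * hubbardGridSub L M'' β N) X Y‖ ≤ α)
    {ρ : ℝ} (hρ : 0 < ρ)
    (hθ : Real.exp 1 * α * normV (GridLeg (GridPoint L N)) (Real.sqrt (2 * ((M'' : ℝ) - M) / (Real.pi * (2 * M + 1)))) ρ
        (fun m' => shellVertexProfile N β U K (2 * m')) / Real.sqrt (2 * ((M'' : ℝ) - M) / (Real.pi * (2 * M + 1))) ^ 2 < 1) :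
    effAction ℂ ((hubbardGridSub L M'' β N).transpose * hubbardCovAboveCT L M'' β μ 0 K Λ * hubbardGridSub L M'' β N)
        (hubbardGridInteraction L N β U + hubbardGridCounterQuadratic L N β K) =
      effAction ℂ ((hubbardGridSub L M β N).transpose * hubbardCovAboveCT L M β μ 0 K Λ * hubbardGridSub L M β N)
        (effAction ℂ ((hubbardGridSub L M'' β N).transpose * hubbardCovShellCT L h β μ 0 K Λ * hubbardGridSub L M'' β N)
          (hubbardGridInteraction L N β U + hubbardGridCounterQuadratic L N β K)) :=
  effAction_gridSub_two_cutoffs h β μ 0 K Λ (fun p : GridPoint L N => p.2) (fun p => gridTime β N p.1) _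
    (sum_norm_kernel_effAction_shell_sub_self_le (L := L) (N := N) hβ hM h U μ K hΛ hΛle hMM hα hrow hcol hρ hθ).1


/-! ### Appended: below the shell floor the infrared slices of the two cutoffs COINCIDE on the grid -/

omit [Fintype P] in
/-- **On one grid the slice covariances of the two cutoffs are EQUAL below the shell floor**:
`S″ᵀ·C″^K_{(Λ,Λ′]}·S″ = Sᵀ·C^K_{(Λ,Λ′]}·S` for `0 < Λ, Λ′ ≤ π(2M+1)/β` — after the scale-`0` step the whole multiscale tower of the cutoff-`M″`
theory on the grid IS the tower of the cutoff-`M` theory (same covariance matrices, same algebra); the cutoffs differ only in the initial vertex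
`W′ = effAction S_g W` versus `W`. [cite: Salmhofer1999, §2.5.1 (2.106)] -/
theorem gridSub_hubbardCovSliceCT_two_cutoffs (h : M ≤ M'') {β : ℝ} (hβ : 0 < β) (μ hs : ℝ) (K : TrigPolyC4v) {Λ Λ' : ℝ}
    (hΛ : 0 < Λ) (hΛle : Λ ≤ Real.pi * (2 * M + 1) / β) (hΛ' : 0 < Λ') (hΛ'le : Λ' ≤ Real.pi * (2 * M + 1) / β)
    (x : P → TorusSite 2 L) (τ : P → ℝ) :
    (gridSubMatrix L M'' β x τ).transpose * hubbardCovSliceCT L M'' β μ hs K Λ Λ' * gridSubMatrix L M'' β x τ =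
      (gridSubMatrix L M β x τ).transpose * hubbardCovSliceCT L M β μ hs K Λ Λ' * gridSubMatrix L M β x τ := by
  rw [hubbardCovSliceCT_eq_windowConj h β μ hs K hβ hΛ hΛle hΛ' hΛ'le, ← windowMatrix_mul_gridSubMatrix h β x τ, Matrix.transpose_mul]
  simp only [Matrix.mul_assoc]

/-- **Hence every infrared step acts identically on both towers**: `effAction (S″ᵀC″_{(Λ,Λ′]}S″) F = effAction (SᵀC_{(Λ,Λ′]}S) F` for every grid
element `F` (below the floor). [cite: Salmhofer1999, §2.5.1 (2.106)] -/
theorem effAction_gridSub_hubbardCovSliceCT_two_cutoffs (h : M ≤ M'') {β : ℝ} (hβ : 0 < β) (μ hs : ℝ) (K : TrigPolyC4v) {Λ Λ' : ℝ}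
    (hΛ : 0 < Λ) (hΛle : Λ ≤ Real.pi * (2 * M + 1) / β) (hΛ' : 0 < Λ') (hΛ'le : Λ' ≤ Real.pi * (2 * M + 1) / β)
    (x : P → TorusSite 2 L) (τ : P → ℝ) (F : GrassmannAlgebra ℂ (GridLeg P)) :
    effAction ℂ ((gridSubMatrix L M'' β x τ).transpose * hubbardCovSliceCT L M'' β μ hs K Λ Λ' * gridSubMatrix L M'' β x τ) F =
      effAction ℂ ((gridSubMatrix L M β x τ).transpose * hubbardCovSliceCT L M β μ hs K Λ Λ' * gridSubMatrix L M β x τ) F := by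
  rw [gridSub_hubbardCovSliceCT_two_cutoffs h hβ μ hs K hΛ hΛle hΛ' hΛ'le]


/-! ### Appended: the window part of the cutoff-`M″` theory is READ from the grid through the cutoff-`M` substitution -/

/-- The composite substitution "grid → cutoff-`M″` fields → window" is the cutoff-`M` grid substitution:
`funLeft emb ∘ toLin' S″ = toLin' S` (`E·S″ = S`). [cite: BenfattoGiulianiMastropietro2006, §2.1 (2.5)] -/
theorem funLeft_emb_comp_toLin'_gridSubMatrix [DecidableEq P] (h : M ≤ M'') (β : ℝ) (x : P → TorusSite 2 L) (τ : P → ℝ) :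
    LinearMap.funLeft ℂ ℂ (HubbardFieldIdx.emb (L := L) h) ∘ₗ Matrix.toLin' (gridSubMatrix L M'' β x τ) = Matrix.toLin' (gridSubMatrix L M β x τ) := by
  rw [← windowMatrix_mul_gridSubMatrix h β x τ, Matrix.toLin'_mul, ← Matrix.toLin'_toMatrix' (LinearMap.funLeft ℂ ℂ (HubbardFieldIdx.emb (L := L) h)),
    toMatrix'_funLeft_emb]

/-- **Restricting the momentum image of a grid element to the window = taking its momentum image at cutoff `M`**:
`π (map S″ F) = map S F` for every grid element `F` — so every window kernel (self-energy, …) of the cutoff-`M″` theory is read from its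
grid effective action through the SAME substitution `hubbardGridSub L M β N` as the cutoff-`M` theory (with `selfEnergy_cutoffRestrict`:
`Σ″(emb k) = selfEnergy (map S G″_g) k`, `Σ(k) = selfEnergy (map S G_g) k`). [cite: BenfattoGiulianiMastropietro2006, §2.1 (2.5)] -/
theorem cutoffRestrict_map_gridSub [DecidableEq P] (h : M ≤ M'') (β : ℝ) (x : P → TorusSite 2 L) (τ : P → ℝ) (F : GrassmannAlgebra ℂ (GridLeg P)) :
    cutoffRestrict L h (ExteriorAlgebra.map (Matrix.toLin' (gridSubMatrix L M'' β x τ)) F) =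
      ExteriorAlgebra.map (Matrix.toLin' (gridSubMatrix L M β x τ)) F := by
  rw [cutoffRestrict, ← AlgHom.comp_apply, ExteriorAlgebra.map_comp_map, funLeft_emb_comp_toLin'_gridSubMatrix]

/-- **The two-cutoff difference of the self-energy at a window label, read from ONE grid**: for grid elements `G″_g, G_g` whose momentum
images are the two effective actions, `Σ(map S″ G″_g)(emb k) − Σ(map S G_g)(k) = Σ(map S (G″_g − G_g))(k)`. [cite: BenfattoGiulianiMastropietro2006, §2.1 (2.5)] -/
theorem selfEnergy_map_gridSub_emb_sub [DecidableEq P] (h : M ≤ M'') (β : ℝ) (x : P → TorusSite 2 L) (τ : P → ℝ)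
    (G'' G : GrassmannAlgebra ℂ (GridLeg P)) (k : FreqMomentum L M) (σ : Fin 2) :
    selfEnergy L M'' β (ExteriorAlgebra.map (Matrix.toLin' (gridSubMatrix L M'' β x τ)) G'') (FreqMomentum.emb h k) σ -
        selfEnergy L M β (ExteriorAlgebra.map (Matrix.toLin' (gridSubMatrix L M β x τ)) G) k σ =
      selfEnergy L M β (ExteriorAlgebra.map (Matrix.toLin' (gridSubMatrix L M β x τ)) (G'' - G)) k σ := by
  have hksub : ∀ (A B : GrassmannAlgebra ℂ (HubbardFieldIdx L M)) (X : Fin 2 → HubbardFieldIdx L M),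
      kernel ℂ (A - B) 2 X = kernel ℂ A 2 X - kernel ℂ B 2 X := by
    intro A B X
    rw [sub_eq_add_neg, kernel_add, ← neg_one_smul ℂ B, kernel_smul, neg_one_mul, ← sub_eq_add_neg]
  rw [← selfEnergy_cutoffRestrict, cutoffRestrict_map_gridSub, map_sub, selfEnergy, selfEnergy, selfEnergy, vertexFn, vertexFn, vertexFn,
    ← mul_sub, hksub]

end Literature.MathematicalPhysics.QuantumLattice
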